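import Summits.MatrixMultiplication.MatrixMultiplication.Theorems.SoloInformedTwistedMatchingsEffectiveCoprime
import HarnessLib

/-!
# Effective Theorem B″ for exponent `p^E · m'`, `p ∤ m'`: the saving on the `p`-part, explicitly

Solo-informed seat (MatrixMultiplication), gen 101; sharpest-statement §2y(8), effective form for general
bounded exponent. `twistedMatching_card_le_effective_of_exponent`: `p` prime, `gcd(p, m') = 1`, level
conditions at `(p, E, u, c)`; if `S` is a finite abelian group with `g^{p^E m'} = 1` then `|S| = a·t` with
`a` a power of `p`, `gcd(p, t) = 1` (so `a = |S_p|`), and every twisted matching in `S` under any finite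
family of automorphism-pair twists has `|ι| ≤ 3 t a^c`. Corollary `twistedMatching_card_le_exp_two_mul_odd`:
exponent `2 m'`, `m'` odd ⟹ `|ι| ≤ 3 t a^{23/25}` with `a = |S_2|`, `t = |S|/a`.
References: BCCGNSU17 (arXiv:1605.06702) §4; CohnUmans2013 (arXiv:1207.6528) §5.
-/

noncomputable section

open scoped BigOperators
open Finset

namespace Summit.MatrixMultiplication.MatrixMultiplication.Theorems.TwistedSliceRank

section EffectiveExponent

/-- **Effective B″ for exponent `p^E m'`, `p ∤ m'`.** Under the level conditions at `(p,E,u,c)`: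
`|S| = a t`, `a` a power of `p`, `gcd(p,t) = 1`, and `|ι| ≤ 3 t a^c` for every twisted matching.
[this work] -/
theorem twistedMatching_card_le_effective_of_exponent (p : ℕ) [hp : Fact p.Prime] (E m' : ℕ)
    (hm' : Nat.Coprime p m') (u c : ℝ) (hu0 : 0 < u) (hu1 : u ≤ 1)
    (hθ : ∀ s : ℕ, s < E →
      u ^ (-(((p - 1 : ℕ) : ℝ)) * ((p : ℝ) + 1) ^ s / 3) *
        ∑ j : Fin p, u ^ (((j : ℕ) : ℝ) * ((p : ℝ) + 1) ^ s) ≤ (p : ℝ) ^ c)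
    (S : Type) [CommGroup S] [Fintype S] [DecidableEq S]
    (hexpS : ∀ g : S, g ^ (p ^ E * m') = 1)
    (σ : Type) [Fintype σ] (φ ψ : σ → S ≃* S) (ι : Type) [Fintype ι] (x y z : ι → S)
    (hmatch : ∀ i j l : ι, (∃ s : σ, x i * φ s (y j) * ψ s (z l) = 1) ↔ (i = j ∧ j = l)) :
    ∃ a t : ℕ, Fintype.card S = a * t ∧ Nat.Coprime p t ∧ (∃ k : ℕ, a = p ^ k) ∧
      (Fintype.card ι : ℝ) ≤ 3 * (t : ℝ) * (a : ℝ) ^ c := by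
  classical
  -- primary decomposition `S ≃* ∏_i ℤ/p_i^{e_i}`
  obtain ⟨κ, _, pp, hpp, e, ⟨f⟩⟩ := AddCommGroup.equiv_directSum_zmod_of_finite (Additive S)
  haveI : ∀ i, NeZero (pp i ^ e i) := fun i => ⟨pow_ne_zero _ (hpp i).ne_zero⟩
  let eS0 : S ≃* ((i : κ) → Multiplicative (ZMod (pp i ^ e i))) :=
    MulEquiv.toAdditive.symm <| f.trans <|
      (DirectSum.addEquivProd _).trans (MulEquiv.piMultiplicative _).toAdditiveRight
  -- `p_i^{e_i} ∣ p^E m'`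
  have hdvd : ∀ i, pp i ^ e i ∣ p ^ E * m' := by
    intro i
    refine (ZMod.natCast_eq_zero_iff _ _).1 ?_
    have h1 := hexpS (eS0.symm (Pi.mulSingle i (Multiplicative.ofAdd (1 : ZMod (pp i ^ e i)))))
    rw [← map_pow, eS0.symm.map_eq_one_iff, ← Pi.mulSingle_pow, ← ofAdd_nsmul, nsmul_eq_mul,
      mul_one] at h1
    have h2 := congr_fun h1 i
    rw [Pi.mulSingle_eq_same, Pi.one_apply, ofAdd_eq_one] at h2
    exact h2
  -- the splitting `S ≃* A × T` along the `p`-primary coordinates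
  let β : κ → Type := fun i => Multiplicative (ZMod (pp i ^ e i))
  let ePi : ((i : κ) → β i) ≃* (((i : {i // pp i = p}) → β i) × ((i : {i // ¬ pp i = p}) → β i)) :=
    { Equiv.piEquivPiSubtypeProd (fun i => pp i = p) β with map_mul' := fun _ _ => rfl }
  let eS := eS0.trans ePi
  have heE : ∀ i : {i // pp i = p}, e i.1 ≤ E := by
    intro i
    have h1 : p ^ e i.1 ∣ p ^ E * m' := by have := hdvd i.1; rwa [i.2] at this
    have h2 : p ^ e i.1 ∣ p ^ E := (Nat.Coprime.pow_left _ hm').dvd_of_dvd_mul_right h1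
    exact (Nat.pow_dvd_pow_iff_le_right hp.out.one_lt).1 h2
  have hT : Nat.Coprime p (Fintype.card ((i : {i // ¬ pp i = p}) → β i)) := by
    simp only [β, Fintype.card_pi, Fintype.card_multiplicative, ZMod.card]
    exact Nat.Coprime.prod_right fun i _ =>
      Nat.Coprime.pow_right _ ((Nat.coprime_primes hp.out (hpp i.1)).2 (Ne.symm i.2))
  have hmain := coprimeTwistedMatching_card_le_effective p E u c hu0 hu1 hθ {i // pp i = p}
    (fun i => pp i.1 ^ e i.1) (fun i => e i.1) (fun i => by rw [i.2]) heE
    ((i : {i // ¬ pp i = p}) → β i) hT S eS σ φ ψ ι x y z hmatch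
  refine ⟨Fintype.card ((i : {i // pp i = p}) → β i), Fintype.card ((i : {i // ¬ pp i = p}) → β i),
    ?_, hT, ⟨∑ i : {i // pp i = p}, e i.1, ?_⟩, hmain⟩
  · rw [Fintype.card_congr eS.toEquiv, Fintype.card_prod]
  · simp only [β, Fintype.card_pi, Fintype.card_multiplicative, ZMod.card]
    rw [← Finset.prod_pow_eq_pow_sum]
    exact Finset.prod_congr rfl fun i _ => by rw [i.2]

/-- **Exponent `2m'`, `m'` odd: `|ι| ≤ 3 t a^{23/25}`** with `a = |S_2|` the order of the Sylow
`2`-subgroup and `t = |S|/a`, for every twisted matching under any finite family of automorphism-pair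
twists. [this work] -/
theorem twistedMatching_card_le_exp_two_mul_odd (m' : ℕ) (hm' : Odd m') (S : Type) [CommGroup S]
    [Fintype S] [DecidableEq S] (hexpS : ∀ g : S, g ^ (2 * m') = 1)
    (σ : Type) [Fintype σ] (φ ψ : σ → S ≃* S) (ι : Type) [Fintype ι] (x y z : ι → S)
    (hmatch : ∀ i j l : ι, (∃ s : σ, x i * φ s (y j) * ψ s (z l) = 1) ↔ (i = j ∧ j = l)) :
    ∃ a t : ℕ, Fintype.card S = a * t ∧ Nat.Coprime 2 t ∧ (∃ k : ℕ, a = 2 ^ k) ∧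
      (Fintype.card ι : ℝ) ≤ 3 * (t : ℝ) * (a : ℝ) ^ (23 / 25 : ℝ) := by
  haveI : Fact (Nat.Prime 2) := ⟨Nat.prime_two⟩
  refine twistedMatching_card_le_effective_of_exponent 2 1 m' (Nat.Coprime.symm hm'.coprime_two_right)
    (1 / 2) (23 / 25) (by norm_num) (by norm_num) ?_ S (fun g => by simpa using hexpS g)
    σ φ ψ ι x y z hmatch
  intro s hs
  interval_cases s
  rw [Fin.sum_univ_two, Fin.val_zero, Fin.val_one]
  norm_num
  rw [one_div (2 : ℝ), Real.inv_rpow (by norm_num), Real.rpow_neg (by norm_num), inv_inv]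
  have h75 : ((2 : ℝ) ^ ((1 : ℝ) / 3) * (3 / 2)) ^ (75 : ℕ) ≤ ((2 : ℝ) ^ ((23 : ℝ) / 25)) ^ (75 : ℕ) := by
    rw [mul_pow, ← Real.rpow_natCast ((2 : ℝ) ^ ((1 : ℝ) / 3)) 75,
      ← Real.rpow_mul (by norm_num), ← Real.rpow_natCast ((2 : ℝ) ^ ((23 : ℝ) / 25)) 75,
      ← Real.rpow_mul (by norm_num),
      show ((1 : ℝ) / 3 * ((75 : ℕ) : ℝ)) = ((25 : ℕ) : ℝ) by norm_num,
      show ((23 : ℝ) / 25 * ((75 : ℕ) : ℝ)) = ((69 : ℕ) : ℝ) by norm_num,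
      Real.rpow_natCast, Real.rpow_natCast]
    norm_num
  have := le_of_pow_le_pow_left₀ (by norm_num) (by positivity) h75
  exact this

end EffectiveExponent

end Summit.MatrixMultiplication.MatrixMultiplication.Theorems.TwistedSliceRank
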